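import Mathlib
import Summits.Ventures.HodgeRepro.Tier4.Target
import Summits.Ventures.HodgeRepro.Tier4.Line3.Defs
import Summits.Ventures.HodgeRepro.Tier4.Line3.LocaliserS
import Summits.Ventures.HodgeRepro.Tier4.Line3.MajorantLemmas
import Summits.Ventures.HodgeRepro.Tier4.Line3.ClassBoundGauss
import Summits.Ventures.HodgeRepro.Tier4.Line3.ClassBound
import Summits.Ventures.HodgeRepro.Tier4.Line3.DecaySum
import Summits.Ventures.HodgeRepro.Tier4.Line3.TermMajorantMass

/-!
# Tier4/Line3/OrbitPartition — THE ASSEMBLY OF L3.5 from the class bound and ONE displayed analytic input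

Blind re-derivation cell `pub-hodge-repro`, Tier 4 «PROVE THE STEP» (README §9–§10), LINE L3, seat t4-L2-p3 on L3.5
`term_dominated` (lead S12234).

THE RESIDUAL (vi) of L3.5 as a structure, `MajorantMassBound`: for the uniform majorant `majorantAt` of the class bound
(`ClassBound.summand_bound_off_main`, exponent `e` of `LocS.growth`), the depth-`N` domain integral of the majorant sum
grows at most like `M₀ q₁^N`:  `∫⁻_{D_N} Σ'_w ofReal (majorantAt Φ e w z) ≤ ofReal (M₀ q₁^N)` (plus pointwise
summability on the domain).  This is the analytic core of step 5 — the `Γ`-invariant half-Gaussian density bounded on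
the cocompact quotient (the BHC cocompactness row), the non-invariant prefactor bounded on the chosen domain
(`{nsq ≤ r}`, `MajorantNorm`), and the index of the level (`CongruenceIndex`, t4-L3-p1's DomainTransfer) — NOT proved here.

THE ASSEMBLY (`term_dominated_of_majorantMassBound`): with (vi), `term_dominated` holds —
`‖term_N o‖ ≤ (B C₁ e^{−κ q^{N/d}} · m_N(o)).toReal` with `m_N(o) = ∫⁻_{D_N} Σ'_{w ∈ o} ofReal (majorantAt)` the orbit's
majorant mass (`norm_integral_le_lintegral_norm`, the class bound pointwise, `lintegral_mono_ae`);
`Σ'_o m_N(o) = ∫⁻_{D_N} Σ'_w ofReal (majorantAt) ≤ ofReal (M₀ q₁^N)` (the orbit partition of the lines: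
`ENNReal.tsum_fiberwise` + `lintegral_tsum`, with the measurability of the majorant from its continuity on the ball);
`bound o := (Σ'_N ofReal (B C₁ e^{−κ q^{N/d}}) · m_N(o)).toReal`, summable over the orbits since
`Σ'_o Σ'_N … = Σ'_N ofReal (B C₁ e^{−κ q^{N/d}}) Σ'_o m_N(o) ≤ Σ'_N ofReal (B C₁ M₀ q₁^N e^{−κ q^{N/d}}) < ∞`
(`DecaySum.summable_pow_mul_exp_neg_root`, `ENNReal.tsum_comm`, `ENNReal.summable_toReal`).

Nothing here asserts anything about the truth of (P); HC_CM is NOT proved by anyone in this repository.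
-/

set_option autoImplicit false

noncomputable section

namespace Summit.Ventures.HodgeRepro.Tier4.Line3

open MeasureTheory Matrix NumberField
open scoped ENNReal

namespace T4Data

variable (X : T4Data)

/-! ### Measurability of the majorant on the ball -/

/-- `aNorm` is continuous on the ball (`KMDatumS.cont`). -/
theorem continuousOn_aNorm (Φ : KMDatumS) (k : Fin 2) : ContinuousOn (fun z => aNorm Φ z k) ball := by
  unfold aNorm
  refine continuousOn_finsetSum _ fun i _ => continuousOn_finsetSum _ fun j _ => ?_
  exact (Φ.cont k i j).norm

/-- The uniform majorant is continuous on the ball. -/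
theorem continuousOn_majorantAt (Φ : KMDatumS) (e : ℝ) (w : X.LineTuple) :
    ContinuousOn (fun z => X.majorantAt Φ e w z) ball := by
  unfold majorantAt
  refine ContinuousOn.mul (((continuousOn_aNorm Φ 0).add (continuousOn_aNorm Φ 1)).pow 4) ?_
  refine continuousOn_finsetProd _ fun j _ => continuousOn_const.mul (continuousOn_const.mul ?_)
  exact Real.continuous_exp.comp_continuousOn (continuousOn_const.mul (IntegrableMajorant.continuousOn_maj' _))

/-- `ofReal ∘ majorantAt` is a.e.-measurable on a measurable subset of the ball. -/
theorem aemeasurable_ofReal_majorantAt (Φ : KMDatumS) (e : ℝ) (w : X.LineTuple) {K : Set (Fin 2 → ℂ)}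
    (hK : MeasurableSet K) (hKb : K ⊆ ball) :
    AEMeasurable (fun z => ENNReal.ofReal (X.majorantAt Φ e w z)) (volume.restrict K) :=
  ENNReal.measurable_ofReal.comp_aemeasurable (((X.continuousOn_majorantAt Φ e w).mono hKb).aemeasurable hK)

/-- The lines and the orbits are countable (the number field is). -/
instance countable_lineTuple : Countable X.LineTuple := by
  haveI : Countable X.E := Finsupp.Countable.of_moduleFinite (R := ℚ)
  haveI : Countable (Fin 3 → X.E) := inferInstance
  haveI : Countable X.Line := inferInstanceAs (Countable (Quot X.lineStep))
  exact inferInstance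

/-- The orbits of lines are countable (a quotient of the countable lines). -/
instance countable_orbit : Countable X.Orbit := inferInstanceAs (Countable (Quot X.orbitStepL))

/-! ### The residual (vi) and the assembly -/

/-- **THE RESIDUAL OF L3.5** as one displayed input: the depth-`N` domain integral of the uniform majorant grows at most
like `M₀ q₁^N`. -/
structure MajorantMassBound (D : X.ThetaData) (p : IsDedekindDomain.HeightOneSpectrum (RingOfIntegers X.E))
    (L₀ : Submodule (RingOfIntegers X.E) (Fin 3 → X.E)) (xm : X.Tuple) (ℓ : X.LocS D p L₀ xm) (e : ℝ) where
  /-- the growth constant -/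
  M₀ : ℝ
  M₀_nonneg : 0 ≤ M₀
  /-- the growth base (the index of the level, `≤ (q₀^d)^9`) -/
  q₁ : ℝ
  q₁_nonneg : 0 ≤ q₁
  /-- the majorant sum converges at every point of the domain -/
  summable : ∀ N (z : Fin 2 → ℂ), z ∈ X.domain (ℓ.level N) → Summable (fun w => X.majorantAt D.Φ e w z)
  /-- the majorant mass of the depth-`N` domain -/
  bound : ∀ N, ∫⁻ z in X.domain (ℓ.level N), ∑' w, ENNReal.ofReal (X.majorantAt D.Φ e w z) ≤
    ENNReal.ofReal (M₀ * q₁ ^ N)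

/-- The orbit's majorant mass at depth `N`. -/
def orbitMass (D : X.ThetaData) (p : IsDedekindDomain.HeightOneSpectrum (RingOfIntegers X.E))
    (L₀ : Submodule (RingOfIntegers X.E) (Fin 3 → X.E)) (xm : X.Tuple) (ℓ : X.LocS D p L₀ xm) (e : ℝ)
    (N : ℕ) (o : X.Orbit) : ℝ≥0∞ :=
  ∫⁻ z in X.domain (ℓ.level N), ∑' w : X.orbitOf ⁻¹' {o}, ENNReal.ofReal (X.majorantAt D.Φ e w.1 z)

/-- **THE ORBIT PARTITION**: the orbit masses add up to the total majorant mass. -/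
theorem tsum_orbitMass (D : X.ThetaData) (p : IsDedekindDomain.HeightOneSpectrum (RingOfIntegers X.E))
    (L₀ : Submodule (RingOfIntegers X.E) (Fin 3 → X.E)) (xm : X.Tuple) (ℓ : X.LocS D p L₀ xm) (e : ℝ) (N : ℕ) :
    ∑' o, X.orbitMass D p L₀ xm ℓ e N o =
      ∫⁻ z in X.domain (ℓ.level N), ∑' w, ENNReal.ofReal (X.majorantAt D.Φ e w z) := by
  unfold orbitMass
  rw [← lintegral_tsum]
  · refine lintegral_congr fun z => ?_
    exact ENNReal.tsum_fiberwise (fun w => ENNReal.ofReal (X.majorantAt D.Φ e w z)) X.orbitOf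
  · intro o
    exact AEMeasurable.tsum fun w =>
      X.aemeasurable_ofReal_majorantAt D.Φ e w.1 (X.measurableSet_domain _) (X.domain_subset_ball _)

/-- **L3.5 FROM THE CLASS BOUND AND THE RESIDUAL.** -/
theorem term_dominated_of_majorantMassBound (D : X.ThetaData)
    (p : IsDedekindDomain.HeightOneSpectrum (RingOfIntegers X.E))
    (L₀ : Submodule (RingOfIntegers X.E) (Fin 3 → X.E)) (xm : X.Tuple)
    (h02 : xm 2 = xm 0) (h13 : xm 3 = xm 1) (hab : LinearIndependent X.E ![xm 0, xm 1]) (ℓ : X.LocS D p L₀ xm)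
    (hq : 1 < (Ideal.absNorm p.asIdeal : ℝ))
    (hres : ∀ e : ℝ, X.MajorantMassBound D p L₀ xm ℓ e) :
    ∃ bound : X.Orbit → ℝ, (∀ o, 0 ≤ bound o) ∧ Summable bound ∧
      ∀ N (o : X.Orbit), o ≠ X.orbitOf (X.lines xm) →
        ‖X.term D.Φ D.cf (ℓ.level N) (ℓ.loc N) o‖ ≤ bound o := by
  obtain ⟨B, e, κ, C₁, hκ, hB, hC₁, hclass⟩ := X.summand_bound_off_main D p L₀ xm h02 h13 hab ℓ
  obtain ⟨M₀, hM₀, q₁, hq₁, hsumm, hmass⟩ := hres e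
  have hdpos : 0 < Module.finrank ℚ X.E := Module.finrank_pos
  -- notation: the decay factor, its `ℝ≥0∞` version, the orbit masses
  obtain ⟨eN, heN⟩ : ∃ eN : ℕ → ℝ, ∀ N, eN N =
      Real.exp (-(κ * (((Ideal.absNorm p.asIdeal : ℝ) ^ N) ^ ((Module.finrank ℚ X.E : ℝ)⁻¹)))) := ⟨_, fun _ => rfl⟩
  have heN0 : ∀ N, 0 ≤ eN N := fun N => by rw [heN]; exact (Real.exp_pos _).le
  obtain ⟨c, hc⟩ : ∃ c : ℕ → ℝ≥0∞, ∀ N, c N = ENNReal.ofReal (B * C₁ * eN N) := ⟨_, fun _ => rfl⟩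
  have hc_ne : ∀ N, c N ≠ ⊤ := fun N => by rw [hc]; exact ENNReal.ofReal_ne_top
  obtain ⟨m, hm⟩ : ∃ m : ℕ → X.Orbit → ℝ≥0∞, ∀ N o, m N o = X.orbitMass D p L₀ xm ℓ e N o := ⟨_, fun _ _ => rfl⟩
  -- (1) the depth-`N` masses add up to at most `ofReal (M₀ q₁^N)`
  have hmass' : ∀ N, ∑' o, m N o ≤ ENNReal.ofReal (M₀ * q₁ ^ N) := fun N => by
    simp only [hm]
    rw [X.tsum_orbitMass]
    exact hmass N
  -- (2) the real series `S N = B C₁ M₀ q₁^N e_N` is summable and nonnegative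
  obtain ⟨S, hS⟩ : ∃ S : ℕ → ℝ, ∀ N, S N = B * C₁ * M₀ * (q₁ ^ N * eN N) := ⟨_, fun _ => rfl⟩
  have hS0 : ∀ N, 0 ≤ S N := fun N => by
    rw [hS]
    exact mul_nonneg (mul_nonneg (mul_nonneg hB hC₁) hM₀) (mul_nonneg (pow_nonneg hq₁ N) (heN0 N))
  have hSsum : Summable S := by
    have h := (summable_pow_mul_exp_neg_root (q₁ := q₁) (q := (Ideal.absNorm p.asIdeal : ℝ)) (κ := κ) hq₁ hq hκ
      (d := Module.finrank ℚ X.E) hdpos).mul_left (B * C₁ * M₀)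
    refine h.congr fun N => ?_
    rw [hS, heN]
  -- (3) `c N * Σ_o m N o ≤ ofReal (S N)`
  have hcm : ∀ N, c N * ∑' o, m N o ≤ ENNReal.ofReal (S N) := fun N => by
    calc c N * ∑' o, m N o ≤ c N * ENNReal.ofReal (M₀ * q₁ ^ N) :=
          mul_le_mul_right (hmass' N) _
      _ = ENNReal.ofReal (S N) := by
          rw [hc, hS, ← ENNReal.ofReal_mul (mul_nonneg (mul_nonneg hB hC₁) (heN0 N))]
          congr 1
          ring
  -- (4) the double sum is finite
  have htotal : ∑' o, ∑' N, c N * m N o ≠ ⊤ := by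
    rw [ENNReal.tsum_comm]
    refine ne_top_of_le_ne_top (b := ∑' N, ENNReal.ofReal (S N)) ?_ ?_
    · rw [← ENNReal.ofReal_tsum_of_nonneg hS0 hSsum]
      exact ENNReal.ofReal_ne_top
    · refine ENNReal.tsum_le_tsum fun N => ?_
      rw [ENNReal.tsum_mul_left]
      exact hcm N
  have hrow : ∀ o, ∑' N, c N * m N o ≠ ⊤ := fun o =>
    ne_top_of_le_ne_top htotal (ENNReal.le_tsum o)
  -- (5) the bound and its properties
  refine ⟨fun o => (∑' N, c N * m N o).toReal, fun o => ENNReal.toReal_nonneg,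
    ENNReal.summable_toReal htotal, fun N o ho => ?_⟩
  -- the orbital term against the orbit's mass, through the class bound
  have hterm : ‖X.term D.Φ D.cf (ℓ.level N) (ℓ.loc N) o‖ ≤ (c N * m N o).toReal := by
    unfold term
    refine (norm_integral_le_lintegral_norm _).trans ?_
    refine ENNReal.toReal_mono (ne_top_of_le_ne_top (hrow o) (ENNReal.le_tsum N)) ?_
    rw [hm, orbitMass, ← lintegral_const_mul' _ _ (hc_ne N)]
    refine lintegral_mono_ae ((ae_restrict_iff' (X.measurableSet_domain _)).mpr (Filter.Eventually.of_forall
      fun z hz => ?_))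
    have hzb : z ∈ ball := X.domain_subset_ball _ hz
    -- the fibre of `o` as the subtype `{w // orbitOf w = o}`
    have hsub : Summable (fun w : {w : X.LineTuple // X.orbitOf w = o} => X.majorantAt D.Φ e w.1 z) :=
      (hsumm N z hz).subtype _
    have hbound : ∀ w : {w : X.LineTuple // X.orbitOf w = o},
        ‖X.summand D.Φ D.cf (ℓ.loc N) w.1 z‖ ≤ (B * C₁ * eN N) * X.majorantAt D.Φ e w.1 z := by
      intro w
      have h := hclass N w.1 z hzb (by rw [w.2]; exact ho)
      rw [heN]
      calc ‖X.summand D.Φ D.cf (ℓ.loc N) w.1 z‖ ≤ B * X.majorantAt D.Φ e w.1 z *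
            (C₁ * Real.exp (-(κ * (((Ideal.absNorm p.asIdeal : ℝ) ^ N) ^ ((Module.finrank ℚ X.E : ℝ)⁻¹))))) := h
        _ = (B * C₁ * Real.exp (-(κ * (((Ideal.absNorm p.asIdeal : ℝ) ^ N) ^ ((Module.finrank ℚ X.E : ℝ)⁻¹))))) *
            X.majorantAt D.Φ e w.1 z := by ring
    have hsumm_norm : Summable (fun w : {w : X.LineTuple // X.orbitOf w = o} =>
        ‖X.summand D.Φ D.cf (ℓ.loc N) w.1 z‖) :=
      Summable.of_nonneg_of_le (fun w => norm_nonneg _) hbound (hsub.mul_left _)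
    have hreal : ‖∑' w : {w : X.LineTuple // X.orbitOf w = o}, X.summand D.Φ D.cf (ℓ.loc N) w.1 z‖ ≤
        (B * C₁ * eN N) * ∑' w : {w : X.LineTuple // X.orbitOf w = o}, X.majorantAt D.Φ e w.1 z := by
      calc ‖∑' w : {w : X.LineTuple // X.orbitOf w = o}, X.summand D.Φ D.cf (ℓ.loc N) w.1 z‖
          ≤ ∑' w : {w : X.LineTuple // X.orbitOf w = o}, ‖X.summand D.Φ D.cf (ℓ.loc N) w.1 z‖ :=
            norm_tsum_le_tsum_norm hsumm_norm
        _ ≤ ∑' w : {w : X.LineTuple // X.orbitOf w = o}, (B * C₁ * eN N) * X.majorantAt D.Φ e w.1 z :=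
            Summable.tsum_le_tsum hbound hsumm_norm (hsub.mul_left _)
        _ = (B * C₁ * eN N) * ∑' w : {w : X.LineTuple // X.orbitOf w = o}, X.majorantAt D.Φ e w.1 z :=
            tsum_mul_left
    -- pass to `ℝ≥0∞` and to the fibre subtype of `orbitMass`
    have hfib : ∑' w : {w : X.LineTuple // X.orbitOf w = o}, ENNReal.ofReal (X.majorantAt D.Φ e w.1 z) =
        ∑' w : X.orbitOf ⁻¹' {o}, ENNReal.ofReal (X.majorantAt D.Φ e w.1 z) :=
      (Equiv.subtypeEquivRight fun w => Iff.rfl).tsum_eq (fun w : X.orbitOf ⁻¹' {o} =>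
        ENNReal.ofReal (X.majorantAt D.Φ e w.1 z))
    calc ENNReal.ofReal ‖∑' w : {w : X.LineTuple // X.orbitOf w = o}, X.summand D.Φ D.cf (ℓ.loc N) w.1 z‖
        ≤ ENNReal.ofReal ((B * C₁ * eN N) *
            ∑' w : {w : X.LineTuple // X.orbitOf w = o}, X.majorantAt D.Φ e w.1 z) := ENNReal.ofReal_le_ofReal hreal
      _ = c N * ∑' w : {w : X.LineTuple // X.orbitOf w = o}, ENNReal.ofReal (X.majorantAt D.Φ e w.1 z) := by
          rw [hc, ENNReal.ofReal_mul (mul_nonneg (mul_nonneg hB hC₁) (heN0 N)),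
            ENNReal.ofReal_tsum_of_nonneg (fun w => X.majorantAt_nonneg _ _ _ _) hsub]
      _ = c N * ∑' w : X.orbitOf ⁻¹' {o}, ENNReal.ofReal (X.majorantAt D.Φ e w.1 z) := by rw [hfib]
  refine hterm.trans ?_
  exact ENNReal.toReal_mono (hrow o) (ENNReal.le_tsum N)

end T4Data

end Summit.Ventures.HodgeRepro.Tier4.Line3

end
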